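/-
Copyright (c) 2026 the pub-hodgecm-mathlib formalisation cell (harness21).  Prover seat hodgecm-mathlib-K2Liu-p13 (g2), Track B «K2-LIT»,
#184♮ = hLiu418 = `stmt-HodgeConjecture-24832`; Road I v3 organ U1-CT-ind STAGE 2 (Q2), file F5-g (LEAD F0P6-plan (g14) 10:39:33Z ∕ 11:15:51Z «F4 → F5 → D-U1 stage 3 =»).
-/
import Summits.HodgeConjecture.HodgeConjecture.Theorems.K2LiuKlingenCellXiOrbitSum          -- ★ F5-a: `hasSum_cellXi`
import Summits.HodgeConjecture.HodgeConjecture.Theorems.K2LiuKlingenCellOneEisensteinU     -- ★∕📤 F5-f: `jAdelic_klingenLevi_one_symm_toAdelic`, `borelU_out_cover∕separate`, `klingenLevi_one_mul` (+ ★ E1 `eisensteinSeriesU`)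
import HarnessLib

/-!
# Crux `HLiu418`, Road I v3, organ U1 stage 2 (Q2), file F5-g: THE `ξ`-CELL OF THE Q-CONSTANT TERM IS E1's BOREL EISENSTEIN SERIES OF THE INNER SECTION —
# `Σ_{x ∈ C₁ᶜ} ∫ β • f(γ_x u Ψ(m_Q(1,g₂)) h) dνN = eisensteinSeriesU (y ↦ ∫ β₁ • f(Ψ(ξ) u Ψ(m_Q(1,y)) h) dνN) g₂`

Cell `hodgecm-mathlib`, crux item hLiu418 = `stmt-HodgeConjecture-24832`; squad K2 ∕ K2Liu; LEAD F0P6-plan (g14), co-dealer K2E5-plan (g7); prover K2Liu-p13 (g2).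
THEOREMS ONLY (no `def`, no instance, no notation, no named-fact hypothesis, no `sorry`); lane `--supports stmt-HodgeConjecture-24832 --as helper` (count-neutral).
THE K2Liu ∕ K2E1 JUNCTION OF THE Q-CONSTANT TERM, term 2 (twin of ★ F5-f).  ★ F5-a `hasSum_cellXi` sums the `ξ`-cell over ANY row section of `B₂(L⁺)\\U(J₂)(L⁺)`; with E1's
row section `Quotient.out` of ★ `K2E1BruhatCosetsU`'s coset type (★ F5-f §2) and the rational-versus-adelic Levi letters (★ F5-f §1) the `ξ`-cell at `Ψ(m_Q(1,g₂)) · h` IS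
`eisensteinSeriesU F_h g₂` for the INNER SECTION `F_h(y) = ∫ β₁(u) • f(Ψ(ξ) · u · Ψ(jAdelic₄ m_Q^𝔸(1, (jAdelic 2)⁻¹ y)) · h) dνN(u)` — a Borel section of `U(J₂)(𝔸)` of character
`χ(b₀₀σ(1)⁻¹)‖b₀₀‖^{s+1}·δ_b` by ★ F5-c∕F5-e (E1's parameter `s − ½` once Haar's `δ_b = ‖b₀₀‖⁻¹` is booked):
* **`tsum_cellXi_eq_eisensteinSeriesU`** (all of ★ F5-a's binders BY VALUE, `hconj` for every rational `g′`), `summable_cellXi_eisensteinU` (the E1 terms are summable).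
[MoeglinWaldspurger1995, II.1.5, II.1.7], [Xiong2013, §4 Prop. 4.1, §7 L. 7.1], [GanTakeda2011SiegelWeil, §7.2 p. 23], [Rogawski1990, §2.2], [Garrett2018, §3.10].
HONEST LABEL.  Count-neutral helper: `HC_CM` is proved only modulo the 7 printed citations (2 remaining named inputs: hLiu418 = `stmt-HodgeConjecture-24832`,
h413 = `stmt-HodgeConjecture-24833`) until rung 0 closes.
-/

set_option autoImplicit false
set_option linter.dupNamespace false -- the mandated namespace repeats `HodgeConjecture.HodgeConjecture`

noncomputable section

open scoped Matrix ENNReal NNReal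
open NumberField IsDedekindDomain MeasureTheory MeasureTheory.Measure MulAction

namespace Summit.HodgeConjecture.HodgeConjecture.Cruxes.HLiu418.K2LiuKlingenCellXiEisensteinU

open Literature.NumberTheory.Automorphic Literature.NumberTheory.Automorphic.UnitaryGroup
open Literature.NumberTheory.GelbartRogawski1991 Literature.NumberTheory.GelbartRogawski1991.GRConstruction
open Literature.NumberTheory.GaloisRepresentations
open Literature.NumberTheory.K2Lit.SiegelDoubled Literature.MeasureTheory.Group
open Summit.HodgeConjecture.HodgeConjecture.Cruxes.HLiu418.K2LiuDoubledUTwoTwoBorelFrame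
open Summit.HodgeConjecture.HodgeConjecture.Cruxes.HLiu418.K2LiuKlingenParabolicDefs
open Summit.HodgeConjecture.HodgeConjecture.Cruxes.HLiu418.K2LiuKlingenUnipotentAdelicDefs
open Summit.HodgeConjecture.HodgeConjecture.Cruxes.HLiu418.K2LiuKlingenRationalCells (complexConj_ringHom_apply_apply)
open Summit.HodgeConjecture.HodgeConjecture.Cruxes.HLiu418.K2LiuKlingenCellOneConstant (conj_mem_klingenUnipA)
open Summit.HodgeConjecture.HodgeConjecture.Cruxes.HLiu418.K2LiuKlingenCellXiOrbitSum (hasSum_cellXi)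
open Summit.HodgeConjecture.HodgeConjecture.Cruxes.HLiu418.K2LiuKlingenCellOneEisensteinU
open Summit.HodgeConjecture.HodgeConjecture.Cruxes.HLiu418.K2LiuSiegelDoubledLeviMatrix (conjAdele_conjAdele')
open Summit.HodgeConjecture.HodgeConjecture.Cruxes.H413.K2E1BorelEisensteinU (eisensteinSeriesU eisensteinSeriesU_def)
open UnitaryDualPair

variable {L : Type} [Field L] [NumberField L] [IsCMField L]
variable {N M : ℕ} {e : Fin N × Fin M ≃ Fin 2}
  {dV : Fin N → L} {hdV : ∀ i, IsCMField.complexConj L (dV i) = dV i}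
  {dW : Fin M → L} {hdW : ∀ i, IsCMField.complexConj L (dW i) = dW i}

section Transport

variable {SA : GL (Fin (2 + 2)) (AdeleRing (𝓞 L) L)}
  {Ψ : (quasiSplit (Fp L) L (IsCMField.complexConj L) (2 + 2)).Adelic ≃ₜ* HA L e dV hdV dW hdW} {X Y : Matrix (Fin 2) (Fin 2) (Fp L)} {a : Fp L}
  (hΨ : ∀ g : (quasiSplit (Fp L) L (IsCMField.complexConj L) (2 + 2)).Adelic,
    (((Ψ g : HA L e dV hdV dW hdW) : GL (Fin (2 + 2)) (AdeleRing (𝓞 L) L)) : Matrix (Fin (2 + 2)) (Fin (2 + 2)) (AdeleRing (𝓞 L) L)) =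
      (SA : Matrix (Fin (2 + 2)) (Fin (2 + 2)) (AdeleRing (𝓞 L) L)) *
        ((adelicVal (Fp L) L (IsCMField.complexConj L) (2 + 2) _ g : GL (Fin (2 + 2)) (AdeleRing (𝓞 L) L)) :
          Matrix (Fin (2 + 2)) (Fin (2 + 2)) (AdeleRing (𝓞 L) L)) *
        ((SA⁻¹ : GL (Fin (2 + 2)) (AdeleRing (𝓞 L) L)) : Matrix (Fin (2 + 2)) (Fin (2 + 2)) (AdeleRing (𝓞 L) L)))
  (ha : a + a = 1)
  (hSA : Matrix.reindex (e₂ (n := 2)).symm (e₂ (n := 2)).symm (SA : Matrix (Fin (2 + 2)) (Fin (2 + 2)) (AdeleRing (𝓞 L) L)) =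
    Matrix.fromBlocks (1 : Matrix (Fin 2) (Fin 2) (AdeleRing (𝓞 L) L)) (X.map ((algebraMap L (AdeleRing (𝓞 L) L)).comp (algebraMap (Fp L) L))) 1
      (-(X.map ((algebraMap L (AdeleRing (𝓞 L) L)).comp (algebraMap (Fp L) L)))))
  (hSAi : Matrix.reindex (e₂ (n := 2)).symm (e₂ (n := 2)).symm ((SA⁻¹ : GL (Fin (2 + 2)) (AdeleRing (𝓞 L) L)) : Matrix (Fin (2 + 2)) (Fin (2 + 2)) (AdeleRing (𝓞 L) L)) =
    Matrix.fromBlocks ((a • (1 : Matrix (Fin 2) (Fin 2) (Fp L))).map ((algebraMap L (AdeleRing (𝓞 L) L)).comp (algebraMap (Fp L) L)))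
      ((a • (1 : Matrix (Fin 2) (Fin 2) (Fp L))).map ((algebraMap L (AdeleRing (𝓞 L) L)).comp (algebraMap (Fp L) L)))
      (Y.map ((algebraMap L (AdeleRing (𝓞 L) L)).comp (algebraMap (Fp L) L)))
      (-(Y.map ((algebraMap L (AdeleRing (𝓞 L) L)).comp (algebraMap (Fp L) L)))))
  (hΨP : ∀ b : (quasiSplit (Fp L) L (IsCMField.complexConj L) (2 + 2)).Adelic,
    ((adelicVal (Fp L) L (IsCMField.complexConj L) (2 + 2) _ b : GL (Fin (2 + 2)) (AdeleRing (𝓞 L) L)) :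
        Matrix (Fin (2 + 2)) (Fin (2 + 2)) (AdeleRing (𝓞 L) L)).BlockTriangular id →
      IsSiegelDelta L e dV hdV dW hdW (Ψ b))
  (hXY : X * Y = a • (1 : Matrix (Fin 2) (Fin 2) (Fp L))) (hYX : Y * X = a • (1 : Matrix (Fin 2) (Fin 2) (Fp L)))

include hΨ ha hSA hSAi hXY hYX in
/-- **(Q2) F5-g — TERM 2 OF THE Q-CONSTANT TERM IS E1's BOREL EISENSTEIN SERIES OF THE INNER SECTION.**  In the setting of ★ F5-a `hasSum_cellXi` (row section := E1's
`Quotient.out`, `hconj` for every rational `g′`), for `h ∈ H(𝔸)` and `g₂ ∈ U(J₂)(𝔸_{L⁺})`: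
  `Σ'_{x ∈ C₁ᶜ} ∫ β(u) • f(γ_x · (u · (Ψ(jAdelic₄ m_Q^𝔸(1,(jAdelic 2)⁻¹ g₂)) · h))) dνN = eisensteinSeriesU (y ↦ ∫ β₁(u) • f(Ψ(ξ) · u · (Ψ(jAdelic₄ m_Q^𝔸(1,(jAdelic 2)⁻¹ y)) · h)) dνN) g₂`.
[cite: MoeglinWaldspurger1995, II.1.7] [cite: Xiong2013, §4 Prop. 4.1] [cite: Rogawski1990, §2.2] -/
theorem tsum_cellXi_eq_eisensteinSeriesU [MeasurableSpace ↥(klingenUnipA Ψ)] [BorelSpace ↥(klingenUnipA Ψ)] (νN : Measure ↥(klingenUnipA Ψ)) [νN.IsMulLeftInvariant]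
    {β : ↥(klingenUnipA Ψ) → ℝ≥0∞} (hβ : IsCoveringWeight ((ratH L e dV hdV dW hdW).subgroupOf (klingenUnipA Ψ)) β)
    {χ : HeckeCharacter L} {s : ℂ} {f : HA L e dV hdV dW hdW → ℂ} (hf : IsSiegelDeltaSection L e dV hdV dW hdW χ s f) (hfc : Continuous f)
    (h : HA L e dV hdV dW hdW) (g₂ : (quasiSplit (Fp L) L (IsCMField.complexConj L) 2).Adelic)
    (hH : ∫⁻ u, (∑' x : SiegelDeltaQuot L e dV hdV dW hdW,
        ‖f ((((Quotient.out x : ratH L e dV hdV dW hdW) : HA L e dV hdV dW hdW)) * ((u : HA L e dV hdV dW hdW) * (Ψ (jAdelic L 4 (klingenLevi (AdeleRing (𝓞 L) L) (conjAdele (Fp L) L (IsCMField.complexConj L)) (conjAdele_conjAdele' L) 1 ((jAdelic L 2).symm g₂))) * h)))‖ₑ) * β u ∂νN ≠ ∞)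
    (C₁ : Set (SiegelDeltaQuot L e dV hdV dW hdW))
    (hC₁ : ∀ x, x ∈ C₁ ↔ ∃ q ∈ klingen L ((IsCMField.complexConj L : L ≃ₐ[Fp L] L) : L →+* L), ∃ γ : ratH L e dV hdV dW hdW,
      (γ : HA L e dV hdV dW hdW) = Ψ (UnitaryGroup.toAdelic (Fp L) L (IsCMField.complexConj L) (2 + 2) ((StdForm.antidiagonal (2 + 2)).over L) q) ∧
        x = Quotient.mk (MulAction.orbitRel (siegelDeltaRat L e dV hdV dW hdW) (ratH L e dV hdV dW hdW)) γ)
    (Γ₁ : Subgroup ↥(klingenUnipA Ψ))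
    (hΓ₁ : ∀ u : ↥(klingenUnipA Ψ), u ∈ Γ₁ ↔ (u : HA L e dV hdV dW hdW) ∈ ratH L e dV hdV dW hdW ∧
      IsSiegelDelta L e dV hdV dW hdW
        (Ψ (UnitaryGroup.toAdelic (Fp L) L (IsCMField.complexConj L) (2 + 2) ((StdForm.antidiagonal (2 + 2)).over L) (weylXi L ((IsCMField.complexConj L : L ≃ₐ[Fp L] L) : L →+* L))) * (u : HA L e dV hdV dW hdW) * (Ψ (UnitaryGroup.toAdelic (Fp L) L (IsCMField.complexConj L) (2 + 2) ((StdForm.antidiagonal (2 + 2)).over L) (weylXi L ((IsCMField.complexConj L : L ≃ₐ[Fp L] L) : L →+* L))))⁻¹))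
    {β₁ : ↥(klingenUnipA Ψ) → ℝ≥0∞} (hβ₁ : IsCoveringWeight Γ₁ β₁)
    (hconj : ∀ g' : unitaryGroupOfForm ((IsCMField.complexConj L : L ≃ₐ[Fp L] L) : L →+* L) ((StdForm.antidiagonal 2).over L), MeasurePreserving (fun u : ↥(klingenUnipA Ψ) =>
      (⟨Ψ (UnitaryGroup.toAdelic (Fp L) L (IsCMField.complexConj L) (2 + 2) ((StdForm.antidiagonal (2 + 2)).over L) (klingenLevi L ((IsCMField.complexConj L : L ≃ₐ[Fp L] L) : L →+* L) (complexConj_ringHom_apply_apply L) 1 g')) * (u : HA L e dV hdV dW hdW) * (Ψ (UnitaryGroup.toAdelic (Fp L) L (IsCMField.complexConj L) (2 + 2) ((StdForm.antidiagonal (2 + 2)).over L) (klingenLevi L ((IsCMField.complexConj L : L ≃ₐ[Fp L] L) : L →+* L) (complexConj_ringHom_apply_apply L) 1 g')))⁻¹,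
        conj_mem_klingenUnipA Ψ (klingenLevi_mem_klingen (complexConj_ringHom_apply_apply L) 1 g') u.2⟩ : ↥(klingenUnipA Ψ))) νN νN) :
    ∑' x : ↥(C₁ᶜ), ∫ u, (β u).toReal • f ((((Quotient.out (x : SiegelDeltaQuot L e dV hdV dW hdW) : ratH L e dV hdV dW hdW) : HA L e dV hdV dW hdW)) *
        ((u : HA L e dV hdV dW hdW) * (Ψ (jAdelic L 4 (klingenLevi (AdeleRing (𝓞 L) L) (conjAdele (Fp L) L (IsCMField.complexConj L)) (conjAdele_conjAdele' L) 1 ((jAdelic L 2).symm g₂))) * h))) ∂νN =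
      eisensteinSeriesU (fun y : (quasiSplit (Fp L) L (IsCMField.complexConj L) 2).Adelic =>
        ∫ u, (β₁ u).toReal •
        f (Ψ (UnitaryGroup.toAdelic (Fp L) L (IsCMField.complexConj L) (2 + 2) ((StdForm.antidiagonal (2 + 2)).over L) (weylXi L ((IsCMField.complexConj L : L ≃ₐ[Fp L] L) : L →+* L))) * (u : HA L e dV hdV dW hdW) * (Ψ (jAdelic L 4 (klingenLevi (AdeleRing (𝓞 L) L) (conjAdele (Fp L) L (IsCMField.complexConj L)) (conjAdele_conjAdele' L) 1 ((jAdelic L 2).symm y))) * h)) ∂νN) g₂ := by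
  have hS := hasSum_cellXi hΨ ha hSA hSAi hXY hYX νN hβ hf hfc (Ψ (jAdelic L 4 (klingenLevi (AdeleRing (𝓞 L) L) (conjAdele (Fp L) L (IsCMField.complexConj L)) (conjAdele_conjAdele' L) 1 ((jAdelic L 2).symm g₂))) * h) hH C₁ hC₁
    (fun q : Quotient (orbitRel ↥(borelU ((IsCMField.complexConj L : L ≃ₐ[Fp L] L) : L →+* L) ((StdForm.antidiagonal 2).over L)) ↥(unitaryGroupOfForm ((IsCMField.complexConj L : L ≃ₐ[Fp L] L) : L →+* L) ((StdForm.antidiagonal 2).over L))) => Quotient.out q) (fun g' => ⟨_, borelU_out_cover g'⟩) borelU_out_separate Γ₁ hΓ₁ hβ₁ (fun i => hconj (Quotient.out i))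
  rw [← hS.tsum_eq, eisensteinSeriesU_def]
  refine tsum_congr fun q => ?_
  have hq : (quasiSplit (Fp L) L (IsCMField.complexConj L) 2).toAdelic (Quotient.out q) =
      UnitaryGroup.toAdelic (Fp L) L (IsCMField.complexConj L) 2 ((StdForm.antidiagonal 2).over L) (Quotient.out q) := rfl
  change _ = ∫ u, (β₁ u).toReal •
        f (Ψ (UnitaryGroup.toAdelic (Fp L) L (IsCMField.complexConj L) (2 + 2) ((StdForm.antidiagonal (2 + 2)).over L) (weylXi L ((IsCMField.complexConj L : L ≃ₐ[Fp L] L) : L →+* L))) * (u : HA L e dV hdV dW hdW) * (Ψ (jAdelic L 4 (klingenLevi (AdeleRing (𝓞 L) L) (conjAdele (Fp L) L (IsCMField.complexConj L)) (conjAdele_conjAdele' L) 1 ((jAdelic L 2).symm ((quasiSplit (Fp L) L (IsCMField.complexConj L) 2).toAdelic (Quotient.out q) * g₂)))) * h)) ∂νN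
  refine integral_congr_ae (Filter.Eventually.of_forall fun u => ?_)
  simp only
  rw [hq, map_mul (jAdelic L 2).symm, klingenLevi_one_mul, map_mul, jAdelic_klingenLevi_one_symm_toAdelic]
  simp only [map_mul, mul_assoc]
  rfl

include hΨ ha hSA hSAi hXY hYX in
/-- **… and the E1 terms are summable** (★ F5-a's `HasSum`). [cite: MoeglinWaldspurger1995, II.1.7] -/
theorem summable_cellXi_eisensteinU [MeasurableSpace ↥(klingenUnipA Ψ)] [BorelSpace ↥(klingenUnipA Ψ)] (νN : Measure ↥(klingenUnipA Ψ)) [νN.IsMulLeftInvariant]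
    {β : ↥(klingenUnipA Ψ) → ℝ≥0∞} (hβ : IsCoveringWeight ((ratH L e dV hdV dW hdW).subgroupOf (klingenUnipA Ψ)) β)
    {χ : HeckeCharacter L} {s : ℂ} {f : HA L e dV hdV dW hdW → ℂ} (hf : IsSiegelDeltaSection L e dV hdV dW hdW χ s f) (hfc : Continuous f)
    (h : HA L e dV hdV dW hdW) (g₂ : (quasiSplit (Fp L) L (IsCMField.complexConj L) 2).Adelic)
    (hH : ∫⁻ u, (∑' x : SiegelDeltaQuot L e dV hdV dW hdW,
        ‖f ((((Quotient.out x : ratH L e dV hdV dW hdW) : HA L e dV hdV dW hdW)) * ((u : HA L e dV hdV dW hdW) * (Ψ (jAdelic L 4 (klingenLevi (AdeleRing (𝓞 L) L) (conjAdele (Fp L) L (IsCMField.complexConj L)) (conjAdele_conjAdele' L) 1 ((jAdelic L 2).symm g₂))) * h)))‖ₑ) * β u ∂νN ≠ ∞)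
    (C₁ : Set (SiegelDeltaQuot L e dV hdV dW hdW))
    (hC₁ : ∀ x, x ∈ C₁ ↔ ∃ q ∈ klingen L ((IsCMField.complexConj L : L ≃ₐ[Fp L] L) : L →+* L), ∃ γ : ratH L e dV hdV dW hdW,
      (γ : HA L e dV hdV dW hdW) = Ψ (UnitaryGroup.toAdelic (Fp L) L (IsCMField.complexConj L) (2 + 2) ((StdForm.antidiagonal (2 + 2)).over L) q) ∧
        x = Quotient.mk (MulAction.orbitRel (siegelDeltaRat L e dV hdV dW hdW) (ratH L e dV hdV dW hdW)) γ)
    (Γ₁ : Subgroup ↥(klingenUnipA Ψ))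
    (hΓ₁ : ∀ u : ↥(klingenUnipA Ψ), u ∈ Γ₁ ↔ (u : HA L e dV hdV dW hdW) ∈ ratH L e dV hdV dW hdW ∧
      IsSiegelDelta L e dV hdV dW hdW
        (Ψ (UnitaryGroup.toAdelic (Fp L) L (IsCMField.complexConj L) (2 + 2) ((StdForm.antidiagonal (2 + 2)).over L) (weylXi L ((IsCMField.complexConj L : L ≃ₐ[Fp L] L) : L →+* L))) * (u : HA L e dV hdV dW hdW) * (Ψ (UnitaryGroup.toAdelic (Fp L) L (IsCMField.complexConj L) (2 + 2) ((StdForm.antidiagonal (2 + 2)).over L) (weylXi L ((IsCMField.complexConj L : L ≃ₐ[Fp L] L) : L →+* L))))⁻¹))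
    {β₁ : ↥(klingenUnipA Ψ) → ℝ≥0∞} (hβ₁ : IsCoveringWeight Γ₁ β₁)
    (hconj : ∀ g' : unitaryGroupOfForm ((IsCMField.complexConj L : L ≃ₐ[Fp L] L) : L →+* L) ((StdForm.antidiagonal 2).over L), MeasurePreserving (fun u : ↥(klingenUnipA Ψ) =>
      (⟨Ψ (UnitaryGroup.toAdelic (Fp L) L (IsCMField.complexConj L) (2 + 2) ((StdForm.antidiagonal (2 + 2)).over L) (klingenLevi L ((IsCMField.complexConj L : L ≃ₐ[Fp L] L) : L →+* L) (complexConj_ringHom_apply_apply L) 1 g')) * (u : HA L e dV hdV dW hdW) * (Ψ (UnitaryGroup.toAdelic (Fp L) L (IsCMField.complexConj L) (2 + 2) ((StdForm.antidiagonal (2 + 2)).over L) (klingenLevi L ((IsCMField.complexConj L : L ≃ₐ[Fp L] L) : L →+* L) (complexConj_ringHom_apply_apply L) 1 g')))⁻¹,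
        conj_mem_klingenUnipA Ψ (klingenLevi_mem_klingen (complexConj_ringHom_apply_apply L) 1 g') u.2⟩ : ↥(klingenUnipA Ψ))) νN νN) :
    Summable (fun q : Quotient (orbitRel ↥(borelU ((IsCMField.complexConj L : L ≃ₐ[Fp L] L) : L →+* L) ((StdForm.antidiagonal 2).over L)) ↥(unitaryGroupOfForm ((IsCMField.complexConj L : L ≃ₐ[Fp L] L) : L →+* L) ((StdForm.antidiagonal 2).over L))) =>
      ∫ u, (β₁ u).toReal •
        f (Ψ (UnitaryGroup.toAdelic (Fp L) L (IsCMField.complexConj L) (2 + 2) ((StdForm.antidiagonal (2 + 2)).over L) (weylXi L ((IsCMField.complexConj L : L ≃ₐ[Fp L] L) : L →+* L))) * (u : HA L e dV hdV dW hdW) * (Ψ (jAdelic L 4 (klingenLevi (AdeleRing (𝓞 L) L) (conjAdele (Fp L) L (IsCMField.complexConj L)) (conjAdele_conjAdele' L) 1 ((jAdelic L 2).symm ((quasiSplit (Fp L) L (IsCMField.complexConj L) 2).toAdelic (Quotient.out q) * g₂)))) * h)) ∂νN) := by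
  have hS := hasSum_cellXi hΨ ha hSA hSAi hXY hYX νN hβ hf hfc (Ψ (jAdelic L 4 (klingenLevi (AdeleRing (𝓞 L) L) (conjAdele (Fp L) L (IsCMField.complexConj L)) (conjAdele_conjAdele' L) 1 ((jAdelic L 2).symm g₂))) * h) hH C₁ hC₁
    (fun q : Quotient (orbitRel ↥(borelU ((IsCMField.complexConj L : L ≃ₐ[Fp L] L) : L →+* L) ((StdForm.antidiagonal 2).over L)) ↥(unitaryGroupOfForm ((IsCMField.complexConj L : L ≃ₐ[Fp L] L) : L →+* L) ((StdForm.antidiagonal 2).over L))) => Quotient.out q) (fun g' => ⟨_, borelU_out_cover g'⟩) borelU_out_separate Γ₁ hΓ₁ hβ₁ (fun i => hconj (Quotient.out i))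
  refine hS.summable.congr fun q => ?_
  have hq : (quasiSplit (Fp L) L (IsCMField.complexConj L) 2).toAdelic (Quotient.out q) =
      UnitaryGroup.toAdelic (Fp L) L (IsCMField.complexConj L) 2 ((StdForm.antidiagonal 2).over L) (Quotient.out q) := rfl
  refine integral_congr_ae (Filter.Eventually.of_forall fun u => ?_)
  simp only
  rw [hq, map_mul (jAdelic L 2).symm, klingenLevi_one_mul, map_mul, jAdelic_klingenLevi_one_symm_toAdelic]
  simp only [map_mul, mul_assoc]
  rfl

end Transport

end Summit.HodgeConjecture.HodgeConjecture.Cruxes.HLiu418.K2LiuKlingenCellXiEisensteinU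

end
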